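import Mathlib
import Literature.NumberTheory.GaloisRepresentations.PhiGammaModuleRobba
import Literature.NumberTheory.GaloisRepresentations.BergerDstOnPhiGamma
import Literature.NumberTheory.GaloisRepresentations.WeilDeligneRep

/-!
# Sketch — first lemmas of the crux ideas for `NonSplitSteinbergPieces` (stmt-Langlands-13451)

Crux-ideate round 1, ideator 1.  Two idea cards:

* `eisenstein-colmez-socle` — first lemma `PairMonodromyNonSplit`: the local dictionary the
  card's global mechanism feeds (a consecutive rank-two piece with non-zero monodromy on its
  `D_st` is non-split).
* `tame-type-bridge` — first lemma `TameTypeForcesMonodromyZero`: the hinge of the `ℓ = p`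
  Ihara-avoidance (a Weil–Deligne representation whose restriction to inertia contains an
  element with pairwise distinct eigenvalues has `N = 0`), and its cut version
  `InertiaEigenspacesStableUnderN` (no Jordan block of `N` crosses an inertia-isotypic cut).

Nothing here is proved; the statements only have to elaborate.
-/

namespace Summit.Langlands.Langlands.Cruxes.NonSplitSteinbergPieces.Sketch

open Literature.NumberTheory.GaloisRepresentations

universe u v w

/-- Card `eisenstein-colmez-socle`, FIRST LEMMA (local dictionary): over a `(φ, Γ_F)`-datum with
Berger's log structure, a consecutive rank-two subquotient `D_i^{i+1}` of a triangulated framed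
module which is semistable with NON-ZERO monodromy on `D_st` has non-zero graded class
(`c_i ≠ 0`).  Contrapositive of "split ⇒ `D_st` splits ⇒ `N = 0` on each rank-one summand".
For the genuine Robba-ring instance this is Berger's theory (rank-one semistable objects are
crystalline, `N` is `F₀ ⊗ E`-linear); over the abstract datum it needs that `F₀`-structure, so it
is a lemma OF THE LINE, not provable from the bare datum. -/
def PairMonodromyNonSplit : Prop :=
  ∀ (p : ℕ) [Fact p.Prime] (F : Type u) [Field F] [TopologicalSpace F]
    (E : Type v) [Field E] [TopologicalSpace E] [IsTopologicalRing E] [Algebra ℚ_[p] E]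
    (𝓣 : PhiGammaModuleRobbaLog.{u, v, w} p F E) (f n : ℕ)
    (D : FramedPhiGammaModule 𝓣.ring n) (T : D.toPhiGammaModule.Triangulation n)
    (i : ℕ) (hi : i + 1 < n),
    𝓣.IsSemistable (T.gradedPair i) f → 𝓣.nDst (T.gradedPair i) ≠ 0 →
      T.IsNonSplitAt 𝓣.gen i hi

/-- Card `tame-type-bridge`, FIRST LEMMA (the hinge of `ℓ = p` Ihara avoidance; provable now):
if some inertia element acts in a Weil–Deligne representation with `n` pairwise distinct
eigenvalues (a tame principal-series inertial type `τ_χ = 1 ⊕ χ ⊕ ⋯ ⊕ χ^{n-1}` with the `χ^j`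
distinct), then `N = 0`: `N` commutes with `ρ(u)` for `u ∈ I_F` (`‖u‖ = 1`), so it preserves the
`n` eigenlines and is nilpotent on each. -/
def TameTypeForcesMonodromyZero : Prop :=
  ∀ (F : Type) [Field F] [ValuativeRel F] [TopologicalSpace F] [IsNonarchimedeanLocalField F]
    (C : Type) [Field C] [CharZero C] (n : ℕ)
    (r : WeilDeligneRep F C (Fin n → C)),
    (∃ u ∈ WeilGroup.inertia F, ∃ c : Fin n → C, Function.Injective c ∧
        ∀ j : Fin n, Module.End.HasEigenvalue (r.ρ u) (c j)) →
      r.N = 0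

/-- Card `tame-type-bridge`, cut version used for a single pair `(i, i+1)` when `n ≥ 3`
(type `τ = (1^i, χ^{n-i})`): the eigenspaces of an inertia element are `N`-stable, so no Jordan
block of `N` crosses the cut between two distinct inertia-isotypic parts. -/
def InertiaEigenspacesStableUnderN : Prop :=
  ∀ (F : Type) [Field F] [ValuativeRel F] [TopologicalSpace F] [IsNonarchimedeanLocalField F]
    (C : Type) [Field C] [CharZero C] (V : Type) [AddCommGroup V] [Module C V]
    [FiniteDimensional C V] (r : WeilDeligneRep F C V) (u : WeilGroup F),
    u ∈ WeilGroup.inertia F → ∀ c : C, ∀ x ∈ Module.End.eigenspace (r.ρ u) c,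
      r.N x ∈ Module.End.eigenspace (r.ρ u) c

end Summit.Langlands.Langlands.Cruxes.NonSplitSteinbergPieces.Sketch
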